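import Mathlib.Analysis.Normed.Ring.InfiniteSum
import Mathlib.Analysis.Normed.Operator.Bilinear
import Mathlib.Analysis.Normed.Operator.NormedSpace
import Mathlib.Topology.Algebra.InfiniteSum.Module

/-!
# Ordered products over words: the noncommutative Cauchy product `(Σ_i a_i)^k = Σ_{i_1…i_k} a_{i_1}⋯a_{i_k}`

Generic summation machinery for power series in NON-COMMUTING variables (the setting of
[Varadarajan1984, Ch. 2 Exercise 43]: «formal power series in `S` with coefficients in `k` … multiplication is
Cauchy: `c_w(xy) = Σ_{w = w'w''} c_{w'}(x) c_{w''}(y)`», words `w` in a free monoid), done analytically in a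
complete normed ring `𝔹`: if `Σ_i a_i = A` converges absolutely then, for every `k`, the family of ORDERED products
`a_{f 0} * a_{f 1} * ⋯ * a_{f (k-1)}` indexed by words `f : Fin k → ι` is absolutely summable with sum `A ^ k`
(`hasSum_wordProd`, `summable_norm_wordProd`), scalars pull out of word products (`wordProd_smul`), norms are
bounded by the word product of the norms (`norm_wordProd_le`), and an absolutely convergent family of continuous
linear maps pairs with an absolutely convergent family of vectors (`hasSum_apply_prod`).  This is the bookkeeping
behind Dynkin's explicit Baker–Campbell–Hausdorff formula [Varadarajan1984, Ch. 2 Exercise 44 (d)]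
(`Literature/Analysis/Calculus/BCHDynkin.lean`), where the letters are the blocks `(ad X)^p (ad Y)^q / (p! q!)`.
Every statement here is the analytic (Banach-algebra) form of the word calculus of [Varadarajan1984, Ch. 2
Exercises 43–44] and is tagged with that locator; Mathlib has the commutative `(∑ a)^k` (`Finset.sum_pow`) and the
two-factor `tsum_mul_tsum_of_summable_norm`, but not the `k`-fold ORDERED version over an infinite alphabet.
-/

noncomputable section

open Filter Finset
open scoped Topology

namespace Literature.Analysis.Calculus.BCH

variable {ι 𝔹 : Type*} [NormedRing 𝔹]

/-- The ordered product `a (f 0) * a (f 1) * ⋯ * a (f (k-1))` of the letters of the word `f : Fin k → ι`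
(empty word ↦ `1`). [cite: Varadarajan1984, Ch. 2 Exercise 43] -/
def wordProd (a : ι → 𝔹) {k : ℕ} (f : Fin k → ι) : 𝔹 := (List.ofFn fun i => a (f i)).prod

/-- The empty word. [cite: Varadarajan1984, Ch. 2 Exercise 43] -/
@[simp] theorem wordProd_zero (a : ι → 𝔹) (f : Fin 0 → ι) : wordProd a f = 1 := by
  simp [wordProd]

/-- Splitting off the first letter. [cite: Varadarajan1984, Ch. 2 Exercise 43] -/
theorem wordProd_succ (a : ι → 𝔹) {k : ℕ} (f : Fin (k + 1) → ι) :
    wordProd a f = a (f 0) * wordProd a (Fin.tail f) := by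
  simp [wordProd, List.ofFn_succ, Fin.tail]

/-- Splitting off the last letter. [cite: Varadarajan1984, Ch. 2 Exercise 43] -/
theorem wordProd_succ_last (a : ι → 𝔹) {k : ℕ} (f : Fin (k + 1) → ι) :
    wordProd a f = wordProd a (Fin.init f) * a (f (Fin.last k)) := by
  simp only [wordProd]
  rw [List.ofFn_succ', List.concat_eq_append, List.prod_append, List.prod_singleton]
  rfl

/-- `Fin.cons` form of `wordProd_succ`. [cite: Varadarajan1984, Ch. 2 Exercise 43] -/
theorem wordProd_cons (a : ι → 𝔹) {k : ℕ} (i : ι) (f : Fin k → ι) :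
    wordProd a (Fin.cons i f : Fin (k + 1) → ι) = a i * wordProd a f := by
  rw [wordProd_succ]; simp

/-- `Fin.snoc` form of `wordProd_succ_last`. [cite: Varadarajan1984, Ch. 2 Exercise 43] -/
theorem wordProd_snoc (a : ι → 𝔹) {k : ℕ} (f : Fin k → ι) (i : ι) :
    wordProd a (Fin.snoc f i : Fin (k + 1) → ι) = wordProd a f * a i := by
  rw [wordProd_succ_last]; simp

/-- In a commutative ring the word product is the ordinary product. [cite: Varadarajan1984, Ch. 2 Exercise 43] -/
theorem wordProd_eq_prod {R : Type*} [NormedCommRing R] (a : ι → R) {k : ℕ} (f : Fin k → ι) :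
    wordProd a f = ∏ i, a (f i) := by
  induction k with
  | zero => simp
  | succ k ih => rw [wordProd_succ, ih, Fin.prod_univ_succ]; rfl

/-- Scalars pull out of a word product: `Π (c_i • a_i) = (Π c_i) • Π a_i`. [cite: Varadarajan1984, Ch. 2 Exercise 43] -/
theorem wordProd_smul {𝕜 : Type*} [NormedField 𝕜] [NormedAlgebra 𝕜 𝔹] (c : ι → 𝕜) (a : ι → 𝔹) {k : ℕ}
    (f : Fin k → ι) : wordProd (fun i => c i • a i) f = (∏ i, c (f i)) • wordProd a f := by
  induction k with
  | zero => simp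
  | succ k ih =>
    rw [wordProd_succ, wordProd_succ, ih, Fin.prod_univ_succ, smul_mul_smul_comm]
    rfl

/-- `‖a_{f 0} ⋯ a_{f (k-1)}‖ ≤ max ‖1‖ 1 · Π ‖a_{f i}‖` (the `max ‖1‖ 1` absorbs the empty word without assuming
`‖(1 : 𝔹)‖ = 1`). [cite: Varadarajan1984, Ch. 2 Exercise 43] -/
theorem norm_wordProd_le (a : ι → 𝔹) {k : ℕ} (f : Fin k → ι) :
    ‖wordProd a f‖ ≤ max ‖(1 : 𝔹)‖ 1 * wordProd (fun i => ‖a i‖) f := by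
  induction k with
  | zero => simp
  | succ k ih =>
    rw [wordProd_succ, wordProd_succ]
    calc ‖a (f 0) * wordProd a (Fin.tail f)‖ ≤ ‖a (f 0)‖ * ‖wordProd a (Fin.tail f)‖ := norm_mul_le _ _
      _ ≤ ‖a (f 0)‖ * (max ‖(1 : 𝔹)‖ 1 * wordProd (fun i => ‖a i‖) (Fin.tail f)) :=
          mul_le_mul_of_nonneg_left (ih _) (norm_nonneg _)
      _ = _ := by ring

/-- Nonnegative letters give nonnegative word products. [cite: Varadarajan1984, Ch. 2 Exercise 43] -/
theorem wordProd_nonneg {a : ι → ℝ} (ha : ∀ i, 0 ≤ a i) {k : ℕ} (f : Fin k → ι) : 0 ≤ wordProd a f := by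
  rw [wordProd_eq_prod]; exact Finset.prod_nonneg fun i _ => ha _

/-- A variant of `norm_wordProd_le` for nonempty words, without the `max ‖1‖ 1`. [cite: Varadarajan1984, Ch. 2 Exercise 43] -/
theorem norm_wordProd_succ_le (a : ι → 𝔹) {k : ℕ} (f : Fin (k + 1) → ι) :
    ‖wordProd a f‖ ≤ wordProd (fun i => ‖a i‖) f := by
  induction k with
  | zero => rw [wordProd_succ, wordProd_succ]; simp
  | succ k ih =>
    rw [wordProd_succ, wordProd_succ (fun i => ‖a i‖)]
    calc ‖a (f 0) * wordProd a (Fin.tail f)‖ ≤ ‖a (f 0)‖ * ‖wordProd a (Fin.tail f)‖ := norm_mul_le _ _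
      _ ≤ ‖a (f 0)‖ * wordProd (fun i => ‖a i‖) (Fin.tail f) :=
          mul_le_mul_of_nonneg_left (ih _) (norm_nonneg _)

section Complete

variable [CompleteSpace 𝔹]

/-- THE NONCOMMUTATIVE CAUCHY PRODUCT.  If `Σ_i a_i = A` with `Σ ‖a_i‖ < ∞`, then for every `k` the ordered
products over words of length `k` are absolutely summable with sum `A ^ k` (the analytic form of the Cauchy
multiplication rule `c_w(xy) = Σ_{w = w'w''} c_{w'}(x)c_{w''}(y)`); `HasSum` and absolute summability are
proved together by induction on the word length. [cite: Varadarajan1984, Ch. 2 Exercise 43] -/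
theorem hasSum_wordProd_and {a : ι → 𝔹} {A : 𝔹} (ha : HasSum a A) (hn : Summable fun i => ‖a i‖) (k : ℕ) :
    HasSum (fun f : Fin k → ι => wordProd a f) (A ^ k) ∧
      Summable (fun f : Fin k → ι => ‖wordProd a f‖) := by
  induction k with
  | zero =>
    refine ⟨?_, ?_⟩
    · simp only [pow_zero]
      have h := hasSum_fintype (fun f : Fin 0 → ι => wordProd a f)
      simp only [Finset.univ_unique, wordProd_zero, Finset.sum_const, Finset.card_singleton, one_smul] at h
      exact h
    · exact (hasSum_fintype _).summable
  | succ k ih =>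
    obtain ⟨ih1, ih2⟩ := ih
    -- the family on `ι × (Fin k → ι)`
    have hN : Summable fun x : ι × (Fin k → ι) => ‖a x.1 * wordProd a x.2‖ := hn.mul_norm ih2
    have hS : HasSum (fun x : ι × (Fin k → ι) => a x.1 * wordProd a x.2) (A * A ^ k) :=
      ha.mul ih1 hN.of_norm
    -- transport along `Fin (k+1) → ι ≃ ι × (Fin k → ι)`
    let e : (Fin (k + 1) → ι) ≃ ι × (Fin k → ι) := (Fin.consEquiv fun _ => ι).symm
    have he : ∀ f : Fin (k + 1) → ι, a (e f).1 * wordProd a (e f).2 = wordProd a f := fun f => by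
      simp only [e, Fin.consEquiv_symm_apply]; rw [wordProd_succ]
    refine ⟨?_, ?_⟩
    · rw [pow_succ']
      have := (e.hasSum_iff (f := fun x : ι × (Fin k → ι) => a x.1 * wordProd a x.2)).2 hS
      exact this.congr_fun fun f => (he f).symm
    · have := (e.summable_iff (f := fun x : ι × (Fin k → ι) => ‖a x.1 * wordProd a x.2‖)).2 hN
      refine this.congr ?_
      intro f; simp only [Function.comp_apply, he]

/-- `Σ_{f : Fin k → ι} a_{f 0} ⋯ a_{f (k-1)} = (Σ a)^k`. [cite: Varadarajan1984, Ch. 2 Exercise 43] -/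
theorem hasSum_wordProd {a : ι → 𝔹} {A : 𝔹} (ha : HasSum a A) (hn : Summable fun i => ‖a i‖) (k : ℕ) :
    HasSum (fun f : Fin k → ι => wordProd a f) (A ^ k) := (hasSum_wordProd_and ha hn k).1

/-- Absolute summability of the ordered products over words of a fixed length. [cite: Varadarajan1984, Ch. 2 Exercise 43] -/
theorem summable_norm_wordProd {a : ι → 𝔹} (hn : Summable fun i => ‖a i‖) (k : ℕ) :
    Summable (fun f : Fin k → ι => ‖wordProd a f‖) :=
  (hasSum_wordProd_and hn.of_norm.hasSum hn k).2

/-- Real (majorant) version: for a summable nonnegative family, `Σ_f Π_i α_{f i} = (Σ α)^k`. [cite: Varadarajan1984, Ch. 2 Exercise 43] -/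
theorem hasSum_wordProd_real {α : ι → ℝ} (h0 : ∀ i, 0 ≤ α i) (hα : Summable α) (k : ℕ) :
    HasSum (fun f : Fin k → ι => wordProd α f) ((∑' i, α i) ^ k) :=
  hasSum_wordProd hα.hasSum (hα.congr fun i => (Real.norm_of_nonneg (h0 i)).symm) k

end Complete

/-! ### Pairing a summable family of operators with a summable family of vectors -/

section Pairing

variable {𝕜 E : Type*} [NontriviallyNormedField 𝕜] [NormedAddCommGroup E] [NormedSpace 𝕜 E] [CompleteSpace E]

/-- If `Σ_i P_i = S` (operator norm, absolutely) and `Σ_j v_j = V` (absolutely) then `Σ_{(i,j)} P_i v_j = S V`,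
absolutely. [cite: Varadarajan1984, Ch. 2 Exercise 43] -/
theorem hasSum_apply_prod {κ μ : Type*} {P : κ → E →L[𝕜] E} {S : E →L[𝕜] E} {v : μ → E} {V : E}
    (hP : HasSum P S) (hPn : Summable fun i => ‖P i‖) (hv : HasSum v V) (hvn : Summable fun j => ‖v j‖) :
    HasSum (fun x : κ × μ => P x.1 (v x.2)) (S V) ∧ Summable (fun x : κ × μ => ‖P x.1 (v x.2)‖) := by
  have hN : Summable (fun x : κ × μ => ‖P x.1 (v x.2)‖) :=
    .of_nonneg_of_le (fun _ => norm_nonneg _) (fun x => (P x.1).le_opNorm (v x.2))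
      (hPn.mul_of_nonneg hvn (fun i => norm_nonneg _) fun j => norm_nonneg _)
  refine ⟨?_, hN⟩
  have hF : HasSum (fun x : κ × μ => P x.1 (v x.2)) (∑' x : κ × μ, P x.1 (v x.2)) := hN.of_norm.hasSum
  -- fiberwise: `Σ_j P_i v_j = P_i V`, then `Σ_i P_i V = S V`
  have h1 : HasSum (fun i => P i V) (∑' x : κ × μ, P x.1 (v x.2)) :=
    hF.prod_fiberwise fun i => (hv.mapL (P i) : _)
  have h2 : HasSum (fun i => P i V) (S V) := by
    simpa using (ContinuousLinearMap.apply 𝕜 E V).hasSum hP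
  rwa [h1.unique h2] at hF

end Pairing

/-! ### Words of length `k + 1` split as (initial word, last letter), majorants, and the sum over all lengths -/

/-- Monotonicity of real word products in the letters. [cite: Varadarajan1984, Ch. 2 Exercise 43] -/
theorem wordProd_mono {α β : ι → ℝ} (h0 : ∀ i, 0 ≤ α i) (h : ∀ i, α i ≤ β i) {k : ℕ} (f : Fin k → ι) :
    wordProd α f ≤ wordProd β f := by
  rw [wordProd_eq_prod, wordProd_eq_prod]
  exact Finset.prod_le_prod (fun i _ => h0 _) fun i _ => h _

/-- `(Fin (k+1) → ι) ≃ (Fin k → ι) × ι`, `f ↦ (Fin.init f, f (Fin.last k))` (a word of `m = k + 1` blocks =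
its first `k` blocks and its last block, the shape of Dynkin's term). [cite: Varadarajan1984, Ch. 2 Exercise 44 (d)] -/
def initLastEquiv (ι : Type*) (k : ℕ) : (Fin (k + 1) → ι) ≃ (Fin k → ι) × ι :=
  (Fin.snocEquiv fun _ => ι).symm.trans (Equiv.prodComm _ _)

/-- `initLastEquiv` unfolds to `(Fin.init f, f (Fin.last k))`. [cite: Varadarajan1984, Ch. 2 Exercise 44 (d)] -/
@[simp] theorem initLastEquiv_apply (k : ℕ) (f : Fin (k + 1) → ι) :
    initLastEquiv ι k f = (Fin.init f, f (Fin.last k)) := rfl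

section Assembly

variable {𝕜 E : Type*} [NontriviallyNormedField 𝕜] [NormedAddCommGroup E] [NormedSpace 𝕜 E] [CompleteSpace E]

/-- Words of `k + 1` letters, the first `k` read as OPERATORS and the last as a VECTOR:
`Σ_f (B_{f 0} ⋯ B_{f (k-1)}) (L_{f k}) = W^k Φ` when `Σ B = W`, `Σ L = Φ` absolutely. [cite: Varadarajan1984, Ch. 2 Exercise 43] -/
theorem hasSum_wordProd_init_apply_last {B : ι → E →L[𝕜] E} {W : E →L[𝕜] E} {L : ι → E} {Φ : E}
    (hB : HasSum B W) (hBn : Summable fun i => ‖B i‖) (hL : HasSum L Φ) (hLn : Summable fun i => ‖L i‖)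
    (k : ℕ) :
    HasSum (fun f : Fin (k + 1) → ι => wordProd B (Fin.init f) (L (f (Fin.last k)))) ((W ^ k) Φ) ∧
      Summable (fun f : Fin (k + 1) → ι => ‖wordProd B (Fin.init f) (L (f (Fin.last k)))‖) := by
  obtain ⟨h1, h2⟩ :=
    hasSum_apply_prod (hasSum_wordProd hB hBn k) (summable_norm_wordProd hBn k) hL hLn
  exact ⟨((initLastEquiv ι k).hasSum_iff
      (f := fun x : (Fin k → ι) × ι => wordProd B x.1 (L x.2))).2 h1,
    ((initLastEquiv ι k).summable_iff
      (f := fun x : (Fin k → ι) × ι => ‖wordProd B x.1 (L x.2)‖)).2 h2⟩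

/-- The majorant of the word family `c_k • (B_{f 0} ⋯ B_{f (k-1)}) (L_{f k})`: `c_k · C · (Π_{i<k} β_{f i}) · λ_{f k}`.
[cite: Varadarajan1984, Ch. 2 Exercise 44 (d)] -/
def wordMajorant (c : ℕ → ℝ) (C : ℝ) (β lam : ι → ℝ) : (Σ k : ℕ, (Fin (k + 1) → ι)) → ℝ :=
  fun w => c w.1 * C * (wordProd β (Fin.init w.2) * lam (w.2 (Fin.last w.1)))

/-- The majorant is nonnegative. [cite: Varadarajan1984, Ch. 2 Exercise 44 (d)] -/
theorem wordMajorant_nonneg {c : ℕ → ℝ} {C : ℝ} {β lam : ι → ℝ} (hc : ∀ k, 0 ≤ c k) (hC : 0 ≤ C)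
    (hβ : ∀ i, 0 ≤ β i) (hl : ∀ i, 0 ≤ lam i) (w : Σ k : ℕ, (Fin (k + 1) → ι)) : 0 ≤ wordMajorant c C β lam w :=
  mul_nonneg (mul_nonneg (hc _) hC) (mul_nonneg (wordProd_nonneg hβ _) (hl _))

/-- The fibre of the majorant over words of length `k + 1` sums to `c_k · C · (Σ β)^k · Σ λ`. [cite: Varadarajan1984, Ch. 2 Exercise 44 (d)] -/
theorem hasSum_wordMajorant_fiber {c : ℕ → ℝ} {C : ℝ} {β lam : ι → ℝ} (hβ0 : ∀ i, 0 ≤ β i)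
    (hl0 : ∀ i, 0 ≤ lam i) (hβ : Summable β) (hl : Summable lam) (k : ℕ) :
    HasSum (fun f : Fin (k + 1) → ι => wordMajorant c C β lam ⟨k, f⟩)
      (c k * C * ((∑' i, β i) ^ k * ∑' i, lam i)) := by
  have h1 : HasSum (fun x : (Fin k → ι) × ι => wordProd β x.1 * lam x.2) ((∑' i, β i) ^ k * ∑' i, lam i) :=
    (hasSum_wordProd_real hβ0 hβ k).mul hl.hasSum
      ((hasSum_wordProd_real hβ0 hβ k).summable.mul_of_nonneg hl (fun f => wordProd_nonneg hβ0 _) hl0)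
  have h2 := ((initLastEquiv ι k).hasSum_iff
      (f := fun x : (Fin k → ι) × ι => wordProd β x.1 * lam x.2)).2 h1
  exact h2.mul_left (c k * C)

/-- Summability of the majorant over ALL word lengths, given `Σ_k c_k (Σ β)^k < ∞`. [cite: Varadarajan1984, Ch. 2 Exercise 44 (d)] -/
theorem summable_wordMajorant {c : ℕ → ℝ} {C : ℝ} {β lam : ι → ℝ} (hc0 : ∀ k, 0 ≤ c k) (hC : 0 ≤ C)
    (hβ0 : ∀ i, 0 ≤ β i) (hl0 : ∀ i, 0 ≤ lam i) (hβ : Summable β) (hl : Summable lam)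
    (hc : Summable fun k => c k * (∑' i, β i) ^ k) : Summable (wordMajorant c C β lam) := by
  refine (summable_sigma_of_nonneg (wordMajorant_nonneg hc0 hC hβ0 hl0)).2 ⟨fun k => ?_, ?_⟩
  · exact (hasSum_wordMajorant_fiber hβ0 hl0 hβ hl k).summable
  · have : (fun k => ∑' f : Fin (k + 1) → ι, wordMajorant c C β lam ⟨k, f⟩) =
        fun k => (C * ∑' i, lam i) * (c k * (∑' i, β i) ^ k) := by
      funext k
      rw [(hasSum_wordMajorant_fiber (c := c) (C := C) hβ0 hl0 hβ hl k).tsum_eq]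
      ring
    rw [this]
    exact hc.mul_left _

omit [CompleteSpace E] in
/-- The word family is dominated by its majorant when `‖B_i‖ ≤ β_i`, `‖L_i‖ ≤ λ_i`. [cite: Varadarajan1984, Ch. 2 Exercise 44 (d)] -/
theorem norm_le_wordMajorant {B : ι → E →L[𝕜] E} {L : ι → E} {β lam : ι → ℝ} (hB : ∀ i, ‖B i‖ ≤ β i)
    (hL : ∀ i, ‖L i‖ ≤ lam i) (c : ℕ → 𝕜) (w : Σ k : ℕ, (Fin (k + 1) → ι)) :
    ‖c w.1 • wordProd B (Fin.init w.2) (L (w.2 (Fin.last w.1)))‖ ≤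
      wordMajorant (fun k => ‖c k‖) (max ‖(1 : E →L[𝕜] E)‖ 1) β lam w := by
  obtain ⟨k, f⟩ := w
  have h0 : ∀ i, 0 ≤ ‖B i‖ := fun i => norm_nonneg _
  have hw : ‖wordProd B (Fin.init f)‖ ≤ max ‖(1 : E →L[𝕜] E)‖ 1 * wordProd β (Fin.init f) :=
    (norm_wordProd_le B _).trans
      (mul_le_mul_of_nonneg_left (wordProd_mono h0 hB _) (le_trans zero_le_one (le_max_right _ _)))
  calc ‖c k • wordProd B (Fin.init f) (L (f (Fin.last k)))‖
      = ‖c k‖ * ‖wordProd B (Fin.init f) (L (f (Fin.last k)))‖ := norm_smul _ _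
    _ ≤ ‖c k‖ * (‖wordProd B (Fin.init f)‖ * ‖L (f (Fin.last k))‖) :=
        mul_le_mul_of_nonneg_left ((wordProd B (Fin.init f)).le_opNorm _) (norm_nonneg _)
    _ ≤ ‖c k‖ * ((max ‖(1 : E →L[𝕜] E)‖ 1 * wordProd β (Fin.init f)) * lam (f (Fin.last k))) := by
        gcongr
        · exact mul_nonneg (le_trans zero_le_one (le_max_right _ _))
            (wordProd_nonneg (fun i => (norm_nonneg _).trans (hB i)) _)
        · exact hL _
    _ = _ := by rw [wordMajorant]; ring

/-- SUM OVER ALL WORD LENGTHS.  If moreover `Σ_k c_k • W^k = G` and the whole word family is summable, then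
`Σ_{k, f} c_k • (B_{f 0} ⋯ B_{f (k-1)}) (L_{f k}) = G Φ`. [cite: Varadarajan1984, Ch. 2 Exercise 44 (d)] -/
theorem hasSum_sigma_wordProd {B : ι → E →L[𝕜] E} {W G : E →L[𝕜] E} {L : ι → E} {Φ : E} {c : ℕ → 𝕜}
    (hB : HasSum B W) (hBn : Summable fun i => ‖B i‖) (hL : HasSum L Φ) (hLn : Summable fun i => ‖L i‖)
    (hc : HasSum (fun k => c k • W ^ k) G)
    (hs : Summable fun w : Σ k : ℕ, (Fin (k + 1) → ι) =>
      c w.1 • wordProd B (Fin.init w.2) (L (w.2 (Fin.last w.1)))) :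
    HasSum (fun w : Σ k : ℕ, (Fin (k + 1) → ι) => c w.1 • wordProd B (Fin.init w.2) (L (w.2 (Fin.last w.1))))
      (G Φ) := by
  have hG : HasSum (fun k => c k • (W ^ k) Φ) (G Φ) := by
    simpa using (ContinuousLinearMap.apply 𝕜 E Φ).hasSum hc
  exact hG.sigma_of_hasSum (fun k => ((hasSum_wordProd_init_apply_last hB hBn hL hLn k).1).const_smul (c k)) hs

end Assembly

end Literature.Analysis.Calculus.BCH

end
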